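import Mathlib
import Summits.ValiantsHypothesis.ValiantsHypothesis.Theorems.LacunarySymmetroidMatrixDescartesCensusKLawBridge
import Summits.ValiantsHypothesis.ValiantsHypothesis.Theorems.LacunarySymmetroidMatrixDescartesRolleSchurStep
import Summits.ValiantsHypothesis.ValiantsHypothesis.Theorems.LacunarySymmetroidMatrixDescartesRolleSchurTelescope
import Summits.ValiantsHypothesis.ValiantsHypothesis.Theorems.LacunarySymmetroidMatrixDescartesRolleSchurForcedZeros

/-!
# LINE `rolle-schur-residual` (D-0145 skeleton) — crux `MatrixDescartes` (stmt-ValiantsHypothesis-18050)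
Seat val-idea-3 (g0), lens «hyperbolic polynomials & interlacing».  Card:
`Summits/ValiantsHypothesis/ValiantsHypothesis/Cruxes/MatrixDescartes/Ideas/rolle-schur-residual.md`.

WHY THIS LINE.  Split a rank-one direction `x^e wwᵀ` off the pencil `F = Σ x^{dₗ}Sₗ` and apply SCALAR Rolle to
`det F / (x^e · wᵀadj(F)w)`; the exact Wronskian is `x^{e−1}·P_{w,e}`, `P_{w,e} = (adj F w)ᵀ(xF′−eF)(adj F w)`
(identities verified symbolically).  Step: `Z₊(det F) ≤ Z₊(P_{w,e}) + Z₊(det F_{w⊥}) + 1 + #common`.  The law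
(`ResidualLaw`) bounds the residual for one good `(w,e)`; telescoping in `m` gives Conjecture B (`KPlusLogSqLaw`),
and the tree bridge `Census.matrixDescartes_of_kPlusLogSqLaw` gives the crux.  The Loewner-sector engine is the
case `min Z₊(P) = 0`; walk reversals force zeros of `P` (`rev F ≤ Z₊(P_{w,e})`).
WHY NOVEL vs listed lines: Lift/OneIndefinite (sign pattern of letters), psd-lift (sector only), TropicalB/WeakLifting
(dominance designs), square_doubling (m → 2m): none has a per-step scalar residual; `DerivedPencilRolle` (dead)
compared `det F` with `det(xF′−eF)` — never done here.
BEARS ON: V2 (B) and V1 (18050 via the bridge).  HONEST: nothing is proved; `stub_residualLaw` is B-hard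
(IncrementLaw ⟺ B in the window); VP ≠ VNP not moved.
CHEAPEST FALSIFIER / INSTRUMENT ROW: exact Sturm count of the integer polynomial `P_{w,e}` on door rows —
(2,6) eighteen `E2-GRAFT18-2-6-0-9-11-12-17-201` (prediction `min_{w,e} Z₊(P) = 17`), (3,4) eighteens
(prediction 17; a value ≤ 7 would both exhibit a B-favourable shift and refute single-branch extremality).
Stubs: `stub_rolleSchurStep` (M, identity + Rolle), `stub_telescope` (M, induction on m + arithmetic),
`stub_residualLaw` (XL, the crux of the line), `stub_forcedZeros` (M, instrument lemma K3, not in the cone of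
`MatrixDescartes_of`: it makes `min_{w,e} Z₊(P_{w,e}) ≥ rev F` a kernel instrument).  Compositions `KPlusLogSqLaw_of`, `MatrixDescartes_of` (zero hypotheses; they
invoke the stubs) are kernel-checked below (no sorry outside `stub_*`).
-/

set_option linter.dupNamespace false
set_option linter.unusedVariables false

open Polynomial Matrix

namespace Summit.ValiantsHypothesis.ValiantsHypothesis.Cruxes.MatrixDescartes.RolleSchur

/-- The lacunary pencil as a polynomial matrix. -/
noncomputable def pencil {m K : ℕ} (d : Fin K → ℕ) (S : Fin K → Matrix (Fin m) (Fin m) ℝ) :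
    Matrix (Fin m) (Fin m) ℝ[X] :=
  ∑ l, ((X : ℝ[X]) ^ d l) • (S l).map C

/-- The shifted pencil `M_e = x F' − e F = ∑ (d_l − e) x^{d_l} S_l` (kills the letter at exponent `e`). -/
noncomputable def shifted {m K : ℕ} (d : Fin K → ℕ) (S : Fin K → Matrix (Fin m) (Fin m) ℝ) (e : ℝ) :
    Matrix (Fin m) (Fin m) ℝ[X] :=
  ∑ l, (C ((d l : ℝ) - e) * (X : ℝ[X]) ^ d l) • (S l).map C

/-- The adjugate vector `u = adj(F) w`. -/
noncomputable def adjVec {m K : ℕ} (d : Fin K → ℕ) (S : Fin K → Matrix (Fin m) (Fin m) ℝ)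
    (w : Fin m → ℝ) : Fin m → ℝ[X] :=
  (pencil d S).adjugate.mulVec (fun i => C (w i))

/-- `a = wᵀ adj(F) w` — `‖w‖²` times the determinant of the compression of `F` to `w^⊥`. -/
noncomputable def compDet {m K : ℕ} (d : Fin K → ℕ) (S : Fin K → Matrix (Fin m) (Fin m) ℝ)
    (w : Fin m → ℝ) : ℝ[X] :=
  (fun i => C (w i)) ⬝ᵥ adjVec d S w

/-- The residual form `P = uᵀ M_e u`, `u = adj(F) w`. -/
noncomputable def residual {m K : ℕ} (d : Fin K → ℕ) (S : Fin K → Matrix (Fin m) (Fin m) ℝ)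
    (w : Fin m → ℝ) (e : ℝ) : ℝ[X] :=
  adjVec d S w ⬝ᵥ (shifted d S e).mulVec (adjVec d S w)

/-- Number of distinct positive real roots of a real polynomial (the zero polynomial has none). -/
noncomputable def posRoots (p : ℝ[X]) : ℕ := (p.roots.toFinset.filter (fun x => 0 < x)).card

/-- **First lemma of card A (exact, to be proved): the Rolle–Schur step.**  For every pencil, vector and
real shift with `a ≢ 0` and `det F ≢ 0`:
`Z₊(det F) ≤ Z₊(P) + Z₊(a) + 1 + #{x > 0 : det F(x) = 0 ∧ a(x) = 0}`.
(Proof sketch: matrix-determinant lemma `det F = det(F − X^e w wᵀ) + X^e a`, Rolle on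
`det F / (X^e a)` between consecutive positive zeros of `a`, and the identity
`Wr(det(F − X^e wwᵀ), X^e a) = − X^(e−1) · P` on `x > 0`.) -/
def RolleSchurStep : Prop :=
  ∀ (m K : ℕ) (d : Fin K → ℕ) (S : Fin K → Matrix (Fin m) (Fin m) ℝ) (w : Fin m → ℝ) (e : ℝ),
    (∀ l, (S l).IsSymm) → compDet d S w ≠ 0 → (pencil d S).det ≠ 0 →
      posRoots (pencil d S).det ≤
        posRoots (residual d S w e) + posRoots (compDet d S w) + 1 +
          (((pencil d S).det.roots.toFinset.filter
              (fun x => 0 < x ∧ (compDet d S w).IsRoot x)).card)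

/-- **Loewner-sector corollary (sanity anchor, to be proved from `RolleSchurStep` by induction on `m`):**
if some real shift makes the shifted pencil positive semidefinite at every `x > 0`, the determinant has at
most `m` positive roots (the cell's `LoewnerSector` engine, re-derived by the scalar Rolle step). -/
def LoewnerSectorViaRolle : Prop :=
  ∀ (m K : ℕ) (d : Fin K → ℕ) (S : Fin K → Matrix (Fin m) (Fin m) ℝ),
    (∀ l, (S l).IsSymm) → (pencil d S).det ≠ 0 →
      (∃ e : ℝ, ∀ x : ℝ, 0 < x → ((shifted d S e).map (Polynomial.eval x)).PosSemidef) →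
        posRoots (pencil d S).det ≤ m

/-- **Card A, format-level law (INCREMENT LAW):** adding one dimension adds at most `2^{C(K+log² m)}`
positive roots — for some direction `w` with non-degenerate compression. Equivalent in strength to
Conjecture B (it implies `KPlusLogSqLaw` by an `m`-step telescope and is implied by it); the point of the
card is the exact residual `P` that controls the increment. -/
def IncrementLaw : Prop :=
  ∃ C : ℕ, ∀ (m K : ℕ) (d : Fin K → ℕ) (S : Fin K → Matrix (Fin m) (Fin m) ℝ),
    (∀ l, (S l).IsSymm) → (pencil d S).det ≠ 0 → 0 < m →
      ∃ w : Fin m → ℝ, compDet d S w ≠ 0 ∧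
        posRoots (pencil d S).det ≤ posRoots (compDet d S w) + 2 ^ (C * (K + Nat.log 2 m ^ 2))

/-- **Card A, located law (RESIDUAL LAW):** some direction `w` and shift `e` make the adjugate curve
`adj(F) w` isotropic for the shifted pencil `M_e` at few points (and meet few common zeros).
`ResidualLaw → IncrementLaw` is immediate from `RolleSchurStep`. -/
def ResidualLaw : Prop :=
  ∃ C : ℕ, ∀ (m K : ℕ) (d : Fin K → ℕ) (S : Fin K → Matrix (Fin m) (Fin m) ℝ),
    (∀ l, (S l).IsSymm) → (pencil d S).det ≠ 0 → 0 < m →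
      ∃ (w : Fin m → ℝ) (e : ℝ), compDet d S w ≠ 0 ∧
        posRoots (residual d S w e) + 1 +
          (((pencil d S).det.roots.toFinset.filter
              (fun x => 0 < x ∧ (compDet d S w).IsRoot x)).card)
            ≤ 2 ^ (C * (K + Nat.log 2 m ^ 2))

/-- The telescope target: `IncrementLaw` gives Conjecture B (needs: `compDet d S w` is `‖w‖²` times the
determinant of an `(m−1, K)` symmetric lacunary pencil; negative roots by `x ↦ −x`; the root `0`). -/
def IncrementTelescope : Prop :=
  IncrementLaw →
    Summit.ValiantsHypothesis.ValiantsHypothesis.Theorems.LacunarySymmetroidMatrixDescartes.KPlusLogSqLaw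


/-! ## Stubs (the line's obligations) and the kernel-checked composition -/

/-- stub (support, M): the Rolle–Schur step — matrix determinant lemma, `adj(F − x^e wwᵀ)w = adj(F)w`,
Wronskian identity `Wr(det(F − x^e wwᵀ), x^e a) = x^{e−1} P`, Rolle on `(0,∞)`.
CLOSED by name since 2026-08-27 (p586469, seat val-width-18050-rs1,
`Theorems/LacunarySymmetroidMatrixDescartesRolleSchurStep.lean`, decl `RolleSchur.rolleSchurStep` =
`RolleSchurStep` with the line vocabulary unfolded, definitionally equal, hence `exact`; route of proof: the
POLYNOMIAL identity `P = X·(f′a − fa′) − e·fa` (`f = det F`, from `adj F·F′·adj F = f′•adj F − f•(adj F)′`), scalar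
Rolle for `x^{−e} f/a` on the gaps of the zero set of `a`, and the gap count `#T ≤ #U + 1`; the hypothesis
`compDet d S w ≠ 0` is not used). -/
theorem stub_rolleSchurStep : RolleSchurStep := by
  exact Summit.ValiantsHypothesis.ValiantsHypothesis.Theorems.LacunarySymmetroidMatrixDescartes.RolleSchur.rolleSchurStep

/-- stub (CRUX of the line, rank 2, XL): the residual law. -/
theorem stub_residualLaw : ResidualLaw := by
  sorry

/-- stub (support, M): the telescope `IncrementLaw → KPlusLogSqLaw` (induction on `m` along `w`;
`compDet d S w = ‖w‖² • det (pencil d S')` for the `(m−1,K)` compression; roots at `x ≤ 0` by `x ↦ −x` and `x = 0`;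
arithmetic `(2m+1)·(2^{C(K+log²m)}+1) ≤ 2^{C'(K+log²m)}`).
CLOSED by name since 2026-08-27 (seat val-width-18050-rs1: `Theorems/LacunarySymmetroidMatrixDescartesRolleSchurTelescope.lean`,
decl `RolleSchur.incrementTelescope` = `IncrementTelescope` with the line vocabulary unfolded, definitionally equal, hence `exact`;
compression lemma `RolleSchur.compDet_eq_C_mul_det_pencil` (`…RolleSchurCompression.lean`, p586961): `compDet d S w = C c · det (pencil d S')`,
`c = (w·w)²/(det T)² ≠ 0`, `S' l = (T S l Tᵀ)` minus first row/column for any invertible frame `T` with `T w = (w·w) e₀`;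
then `stub_negRoots` and `C' = C + 4`). -/
theorem stub_telescope : IncrementTelescope := by
  exact Summit.ValiantsHypothesis.ValiantsHypothesis.Theorems.LacunarySymmetroidMatrixDescartes.RolleSchur.incrementTelescope

/-- stub (support, M; INSTRUMENT lemma K3 «forced zeros», typed at critic-1's request): between two CONSECUTIVE SIMPLE
positive roots `x₁ < x₂` of `det F` whose eigenvalue crossings have OPPOSITE directions (a walk reversal; direction at a
simple root with kernel vector `k` is the Hellmann–Feynman sign of `kᵀF′(x₀)k`), the residual `P_{w,e}` vanishes somewhere,
for every shift `e` and every `w` not orthogonal to the two kernel lines.  Proof sketch: on `(x₁,x₂)`,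
`r(x) = x^e·wᵀF(x)⁻¹w` satisfies `r′ = −x^{e−1}·P_{w,e}/det²`, and `r → ±∞` at both ends with the SAME sign under the
reversal hypothesis, so `r` has an interior critical point.  Consequence: `rev(F) ≤ Z₊(P_{w,e})`. -/
theorem stub_forcedZeros :
    ∀ (m K : ℕ) (d : Fin K → ℕ) (S : Fin K → Matrix (Fin m) (Fin m) ℝ) (w : Fin m → ℝ) (e x₁ x₂ : ℝ)
      (k₁ k₂ : Fin m → ℝ),
      (∀ l, (S l).IsSymm) → 0 < x₁ → x₁ < x₂ →
      ((pencil d S).map (Polynomial.eval x₁)).mulVec k₁ = 0 → k₁ ≠ 0 →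
      ((pencil d S).map (Polynomial.eval x₂)).mulVec k₂ = 0 → k₂ ≠ 0 →
      (∀ x, x₁ < x → x < x₂ → (pencil d S).det.eval x ≠ 0) →
      (Polynomial.derivative (pencil d S).det).eval x₁ ≠ 0 →
      (Polynomial.derivative (pencil d S).det).eval x₂ ≠ 0 →
      w ⬝ᵥ k₁ ≠ 0 → w ⬝ᵥ k₂ ≠ 0 →
      (k₁ ⬝ᵥ ((pencil d S).map (fun p => (Polynomial.derivative p).eval x₁)).mulVec k₁) *
          (k₂ ⬝ᵥ ((pencil d S).map (fun p => (Polynomial.derivative p).eval x₂)).mulVec k₂) < 0 →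
      ∃ x, x₁ < x ∧ x < x₂ ∧ (residual d S w e).eval x = 0 := by
  -- CLOSED by name since 2026-08-28 (seat val-width-18050-rs1: `Theorems/…RolleSchurForcedZeros.lean`, decl
  -- `RolleSchur.forcedZeros` = this statement with the line vocabulary unfolded; route: Hellmann–Feynman identity
  -- `a(x₀)·kᵀF′(x₀)k = f′(x₀)(w·k)²` at a simple root (Jacobi + `ker F(x₀) = ℝk`), `P(x₀) = x₀ f′(x₀) a(x₀)` at a root,
  -- hence `P(x₁)P(x₂) < 0` under the reversal hypothesis, IVT; the «no root in (x₁,x₂)» hypothesis is not used).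
  exact Summit.ValiantsHypothesis.ValiantsHypothesis.Theorems.LacunarySymmetroidMatrixDescartes.RolleSchur.forcedZeros

/-- `ResidualLaw` + the step give the increment law (proved: bookkeeping only). -/
theorem incrementLaw_of_residualLaw (hstep : RolleSchurStep) (hres : ResidualLaw) : IncrementLaw := by
  obtain ⟨C, hC⟩ := hres
  refine ⟨C, fun m K d S hS hdet hm => ?_⟩
  obtain ⟨w, e, hw, hb⟩ := hC m K d S hS hdet hm
  have h := hstep m K d S w e hS hw hdet
  exact ⟨w, hw, by omega⟩

/-- COMPOSITION (kernel-checked): the three stubs give Conjecture B … -/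
theorem KPlusLogSqLaw_of :
    Summit.ValiantsHypothesis.ValiantsHypothesis.Theorems.LacunarySymmetroidMatrixDescartes.KPlusLogSqLaw :=
  stub_telescope (incrementLaw_of_residualLaw stub_rolleSchurStep stub_residualLaw)

/-- … and the crux `MatrixDescartes` BY NAME, through the proved tree bridge
`Census.matrixDescartes_of_kPlusLogSqLaw`. -/
theorem MatrixDescartes_of :
    Summit.ValiantsHypothesis.ValiantsHypothesis.Theses.LacunarySymmetroid.MatrixDescartes :=
  Summit.ValiantsHypothesis.ValiantsHypothesis.Theorems.LacunarySymmetroidMatrixDescartes.Census.matrixDescartes_of_kPlusLogSqLaw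
    KPlusLogSqLaw_of

end Summit.ValiantsHypothesis.ValiantsHypothesis.Cruxes.MatrixDescartes.RolleSchur
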